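import Mathlib.RingTheory.DiscreteValuationRing.Basic
import Mathlib.RingTheory.Polynomial.UniqueFactorization
import Mathlib.RingTheory.Polynomial.Basic
import Mathlib.RingTheory.UniqueFactorizationDomain.Multiplicity
import Mathlib.RingTheory.Localization.FractionRing
import Mathlib.RingTheory.AlgebraicIndependent.Adjoin
import Mathlib.RingTheory.AlgebraicIndependent.TranscendenceBasis
import Mathlib.RingTheory.AlgebraicIndependent.AlgebraicClosure
import Mathlib.FieldTheory.IntermediateField.Adjoin.Algebra
import Mathlib.RingTheory.Norm.Basic
import HarnessLib

/-!
# The Gauss `ϖ`-order on `F(t_i)_{i ∈ ι}` for the fraction field `F` of a DVR, proof-only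

Generalisation of `PadicGaussValuation.lean` (abc-iut-L4-d2, p408085: the case `ℤ_p ⊂ ℚ_p`) to an
arbitrary discrete valuation ring `A` with uniformizer `ϖ` and fraction field `F`: on the rational
function field `F(t_i)` there is a homomorphism of the unit group to `ℤ` sending `ϖ` to `1`
(`exists_unitsHom_fractionRing_mvPolynomial_of_irreducible`; the multiplicity of the prime
`ϖ ∈ A[t_i]` after clearing `ϖ`-power denominators — Gauss's lemma is the primality of `ϖ` in
`A[t_i]`), and consequently every finitely generated field extension `L` of `F` admits a homomorphism
`L^× → ℤ` not vanishing at `ϖ` (`exists_unitsHom_of_essFiniteType_of_irreducible`; transcendence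
basis and the norm `N_{L/F(t)}`).  Used with `A = W(𝔽̄_p)` for the class-field-theory-free proof of
[Tpcs] Lem 4.14 (slimness of `G_K` for generalized sub-`p`-adic `K`; cell file
`RelativeGrothendieckConjecture.lean`, `Tpcs.Lem_4_14`).  No definitions; Mathlib only.
[cite: MochizukiTopics2003, Lem 4.14 p.48]
-/

noncomputable section

open scoped Classical
open MvPolynomial

namespace Literature.AnabelianGeometry.AbsoluteAnabelian

section Gauss

variable (A F : Type) [CommRing A] [IsDomain A] [IsDiscreteValuationRing A] [Field F]
  [Algebra A F] [IsFractionRing A F] {ϖ : A} (hϖ : Irreducible ϖ) (ι : Type)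

include hϖ

/-- Clearing denominators over a DVR: every element of `F = Frac A` becomes integral after
multiplication by a power of the uniformizer `ϖ`. [folklore] -/
private theorem exists_pow_mul_mem_range (x : F) :
    ∃ (k : ℕ) (a : A), (algebraMap A F ϖ) ^ k * x = algebraMap A F a := by
  obtain ⟨⟨a, s⟩, hx⟩ := IsLocalization.surj (nonZeroDivisors A) x
  -- `x * s = a`
  have hs0 : (s : A) ≠ 0 := nonZeroDivisors.ne_zero s.2
  obtain ⟨k, u, hu⟩ := IsDiscreteValuationRing.eq_unit_mul_pow_irreducible hs0 hϖ
  -- `s = u * ϖ ^ k`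
  refine ⟨k, a * ↑u⁻¹, ?_⟩
  have hsF : algebraMap A F (s : A) = algebraMap A F (u : A) * algebraMap A F ϖ ^ k := by
    rw [hu, map_mul, map_pow]
  have huF : algebraMap A F (u : A) * algebraMap A F (↑u⁻¹ : A) = 1 := by
    rw [← map_mul, Units.mul_inv, map_one]
  calc algebraMap A F ϖ ^ k * x
      = x * algebraMap A F (s : A) * algebraMap A F (↑u⁻¹ : A) := by
        rw [hsF]
        linear_combination (-(algebraMap A F ϖ ^ k * x)) * huF
    _ = algebraMap A F (a * ↑u⁻¹) := by rw [hx, map_mul]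

/-- Clearing denominators: every `f ∈ F[t_i]` becomes `ϖ`-integral after multiplication by a power
of `ϖ`. [folklore] -/
private theorem exists_pow_mul_eq_map (f : MvPolynomial ι F) :
    ∃ (k : ℕ) (g : MvPolynomial ι A),
      C ((algebraMap A F ϖ) ^ k) * f = MvPolynomial.map (algebraMap A F) g := by
  -- a common exponent
  choose kx ax hkx using fun x : F => exists_pow_mul_mem_range A F hϖ x
  let k : ℕ := f.support.sup fun m => kx (f.coeff m)
  have hk : ∀ m ∈ f.support, ∃ a : A, (algebraMap A F ϖ) ^ k * f.coeff m = algebraMap A F a := by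
    intro m hm
    have hle : kx (f.coeff m) ≤ k := Finset.le_sup (f := fun m => kx (f.coeff m)) hm
    obtain ⟨j, hj⟩ := Nat.exists_eq_add_of_le hle
    refine ⟨ϖ ^ j * ax (f.coeff m), ?_⟩
    rw [hj, pow_add, mul_comm ((algebraMap A F ϖ) ^ _) _, mul_assoc, hkx, map_mul, map_pow]
  -- integral coefficients
  choose! a ha using hk
  let g : MvPolynomial ι A := ∑ m ∈ f.support, monomial m (a m)
  have hcoeff : ∀ m, g.coeff m = if m ∈ f.support then a m else 0 := by
    intro m
    simp only [g, coeff_sum, coeff_monomial]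
    rw [Finset.sum_ite_eq' f.support m a]
  refine ⟨k, g, ?_⟩
  ext m
  rw [coeff_C_mul, coeff_map, hcoeff]
  by_cases hm : m ∈ f.support
  · rw [if_pos hm]
    exact ha m hm
  · have h0 : f.coeff m = 0 := by simpa [MvPolynomial.mem_support_iff] using hm
    rw [if_neg hm, h0, mul_zero, map_zero]

/-- The `ϖ`-ORDER on `F[t_i] ∖ {0}`: there is a function `c` with `c(fg) = c(f) + c(g)` for
`f, g ≠ 0` and `c(ϖ) = 1` (multiplicity of the prime `ϖ ∈ A[t_i]` after clearing denominators;
Gauss's lemma is the primality of `ϖ` in `A[t_i]`). [folklore] -/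
private theorem exists_order_mvPolynomial :
    ∃ c : MvPolynomial ι F → ℤ,
      (∀ f g : MvPolynomial ι F, f ≠ 0 → g ≠ 0 → c (f * g) = c f + c g) ∧
      c (C (algebraMap A F ϖ)) = 1 := by
  haveI : UniqueFactorizationMonoid A := inferInstance
  have hϖprime : Prime ϖ := hϖ.prime
  have hϖF0 : algebraMap A F ϖ ≠ 0 :=
    (map_ne_zero_iff _ (IsFractionRing.injective A F)).mpr hϖ.ne_zero
  set π : MvPolynomial ι A := C ϖ with hπ
  have hπprime : Prime π := (MvPolynomial.prime_C_iff (σ := ι)).mpr hϖprime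
  have hinj : Function.Injective (MvPolynomial.map (σ := ι) (algebraMap A F)) :=
    MvPolynomial.map_injective _ (IsFractionRing.injective A F)
  have hmapπ : ∀ k : ℕ, MvPolynomial.map (algebraMap A F) (π ^ k) =
      C ((algebraMap A F ϖ) ^ k) := by
    intro k
    rw [hπ, map_pow, map_C, ← C_pow]
  -- representations and their invariance
  have hwd : ∀ (f : MvPolynomial ι F) (k k' : ℕ) (g g' : MvPolynomial ι A), f ≠ 0 →
      C ((algebraMap A F ϖ) ^ k) * f = MvPolynomial.map (algebraMap A F) g →
      C ((algebraMap A F ϖ) ^ k') * f = MvPolynomial.map (algebraMap A F) g' →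
      (multiplicity π g : ℤ) - k = (multiplicity π g' : ℤ) - k' := by
    intro f k k' g g' hf hg hg'
    have hg0 : g ≠ 0 := by
      rintro rfl
      rw [map_zero, mul_eq_zero] at hg
      rcases hg with h | h
      · exact (pow_ne_zero k hϖF0) (C_eq_zero.mp h)
      · exact hf h
    have hg'0 : g' ≠ 0 := by
      rintro rfl
      rw [map_zero, mul_eq_zero] at hg'
      rcases hg' with h | h
      · exact (pow_ne_zero k' hϖF0) (C_eq_zero.mp h)
      · exact hf h
    -- `π^k' g = π^k g'`
    have heq : π ^ k' * g = π ^ k * g' := by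
      apply hinj
      rw [map_mul, map_mul, hmapπ, hmapπ, ← hg, ← hg', ← mul_assoc, ← mul_assoc, ← map_mul C,
        ← map_mul C, ← pow_add, ← pow_add, add_comm]
    have hfin : FiniteMultiplicity π (π ^ k' * g) :=
      FiniteMultiplicity.of_prime_left hπprime (mul_ne_zero (pow_ne_zero _ hπprime.ne_zero) hg0)
    have hfin' : FiniteMultiplicity π (π ^ k * g') :=
      FiniteMultiplicity.of_prime_left hπprime (mul_ne_zero (pow_ne_zero _ hπprime.ne_zero) hg'0)
    have h1 := multiplicity_mul hπprime hfin
    have h2 := multiplicity_mul hπprime hfin'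
    rw [multiplicity_pow_self_of_prime hπprime] at h1 h2
    rw [heq] at h1
    have : (k' : ℤ) + multiplicity π g = k + multiplicity π g' := by exact_mod_cast h1.symm.trans h2
    linarith
  -- the function
  choose kf gf hrep using exists_pow_mul_eq_map A F hϖ ι
  refine ⟨fun f => (multiplicity π (gf f) : ℤ) - kf f, ?_, ?_⟩
  · intro f g hf hg
    beta_reduce
    -- `(kf f + kf g, gf f * gf g)` represents `f * g`
    have hrep' : C ((algebraMap A F ϖ) ^ (kf f + kf g)) * (f * g) =
        MvPolynomial.map (algebraMap A F) (gf f * gf g) := by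
      rw [map_mul, ← hrep f, ← hrep g, pow_add, map_mul C]
      ring
    have hw := hwd (f * g) (kf (f * g)) (kf f + kf g) (gf (f * g)) (gf f * gf g)
      (mul_ne_zero hf hg) (hrep (f * g)) hrep'
    have hgf : gf f ≠ 0 := by
      intro h
      have := hrep f
      rw [h, map_zero, mul_eq_zero] at this
      rcases this with h' | h'
      · exact (pow_ne_zero _ hϖF0) (C_eq_zero.mp h')
      · exact hf h'
    have hgg : gf g ≠ 0 := by
      intro h
      have := hrep g
      rw [h, map_zero, mul_eq_zero] at this
      rcases this with h' | h'
      · exact (pow_ne_zero _ hϖF0) (C_eq_zero.mp h')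
      · exact hg h'
    have hfin : FiniteMultiplicity π (gf f * gf g) :=
      FiniteMultiplicity.of_prime_left hπprime (mul_ne_zero hgf hgg)
    have hm := multiplicity_mul hπprime hfin
    rw [hw, hm]
    push_cast
    ring
  · -- `(0, π)` represents `C ϖ`
    beta_reduce
    have hrep' : C ((algebraMap A F ϖ) ^ 0) * C (algebraMap A F ϖ) =
        MvPolynomial.map (algebraMap A F) π := by
      rw [pow_zero, C_1, one_mul, hπ, map_C]
    have hw := hwd (C (algebraMap A F ϖ)) (kf _) 0 (gf _) π
      (C_eq_zero.not.mpr hϖF0) (hrep _) hrep'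
    rw [hw, multiplicity_self]
    simp

/-- On the rational function field `F(t_i) = Frac F[t_i]` over the fraction field `F` of a DVR
`A` with uniformizer `ϖ` there is a homomorphism of the unit group to `ℤ` taking the value `1` at
`ϖ` (the Gauss `ϖ`-order extended to fractions). [cite: MochizukiTopics2003, Lem 4.14 p.48] -/
theorem exists_unitsHom_fractionRing_mvPolynomial_of_irreducible :
    ∃ u : (FractionRing (MvPolynomial ι F))ˣ →* Multiplicative ℤ,
      ∀ z : (FractionRing (MvPolynomial ι F))ˣ,
        (z : FractionRing (MvPolynomial ι F)) =
          algebraMap (MvPolynomial ι F) _ (C (algebraMap A F ϖ)) →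
            u z = Multiplicative.ofAdd 1 := by
  obtain ⟨c, hcmul, hcp⟩ := exists_order_mvPolynomial A F hϖ ι
  have hc1 : c 1 = 0 := by
    have := hcmul 1 1 one_ne_zero one_ne_zero
    rw [one_mul] at this
    linarith
  -- representatives `z * s = a`
  have hsurj := fun z : FractionRing (MvPolynomial ι F) =>
    IsLocalization.surj (nonZeroDivisors (MvPolynomial ι F)) z
  choose rep hrep using hsurj
  have hinj : Function.Injective
      (algebraMap (MvPolynomial ι F) (FractionRing (MvPolynomial ι F))) :=
    IsFractionRing.injective _ _
  -- the value `c a - c s` does not depend on the representative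
  have hval : ∀ (z : FractionRing (MvPolynomial ι F)) (a a' : MvPolynomial ι F)
      (s s' : nonZeroDivisors (MvPolynomial ι F)), z ≠ 0 →
      z * algebraMap _ _ (s : MvPolynomial ι F) = algebraMap _ _ a →
      z * algebraMap _ _ (s' : MvPolynomial ι F) = algebraMap _ _ a' →
      c a - c (s : MvPolynomial ι F) = c a' - c (s' : MvPolynomial ι F) := by
    intro z a a' s s' hz hs hs'
    have hs0 : (s : MvPolynomial ι F) ≠ 0 := nonZeroDivisors.ne_zero s.2
    have hs'0 : (s' : MvPolynomial ι F) ≠ 0 := nonZeroDivisors.ne_zero s'.2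
    have ha0 : a ≠ 0 := by
      rintro rfl
      rw [map_zero, mul_eq_zero] at hs
      rcases hs with h | h
      · exact hz h
      · exact hs0 (hinj (by rw [h, map_zero]))
    have ha'0 : a' ≠ 0 := by
      rintro rfl
      rw [map_zero, mul_eq_zero] at hs'
      rcases hs' with h | h
      · exact hz h
      · exact hs'0 (hinj (by rw [h, map_zero]))
    have heq : a * s' = a' * s := by
      apply hinj
      rw [map_mul, map_mul, ← hs, ← hs']
      ring
    have := congrArg c heq
    rw [hcmul _ _ ha0 hs'0, hcmul _ _ ha'0 hs0] at this
    linarith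
  refine ⟨{ toFun := fun z => Multiplicative.ofAdd
              (c (rep z.val).1 - c ((rep z.val).2 : MvPolynomial ι F))
            map_one' := ?_
            map_mul' := ?_ }, ?_⟩
  · -- `1 = 1/1`
    have h := hval 1 _ 1 _ 1 one_ne_zero (hrep 1) (by simp)
    simp only [Units.val_one] at h ⊢
    rw [h, OneMemClass.coe_one, hc1, sub_zero]
    rfl
  · intro z z'
    have hz : (z : FractionRing (MvPolynomial ι F)) ≠ 0 := z.ne_zero
    have hz' : (z' : FractionRing (MvPolynomial ι F)) ≠ 0 := z'.ne_zero
    -- the product of representatives represents the product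
    have hprod : (z * z').val *
        algebraMap _ _ (((rep z.val).2 * (rep z'.val).2 : nonZeroDivisors (MvPolynomial ι F)) :
          MvPolynomial ι F) = algebraMap _ _ ((rep z.val).1 * (rep z'.val).1) := by
      rw [Units.val_mul, Submonoid.coe_mul, map_mul, map_mul, ← hrep z.val, ← hrep z'.val]
      ring
    have h := hval _ _ _ _ _ (mul_ne_zero hz hz') (hrep (z * z').val) hprod
    rw [← ofAdd_add, h, Submonoid.coe_mul,
      hcmul _ _ ?_ ?_, hcmul _ _ (nonZeroDivisors.ne_zero (rep z.val).2.2)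
        (nonZeroDivisors.ne_zero (rep z'.val).2.2)]
    · congr 1
      ring
    · -- numerators are nonzero
      intro h0
      have := hrep z.val
      rw [h0, map_zero, mul_eq_zero] at this
      rcases this with h1 | h1
      · exact hz h1
      · exact nonZeroDivisors.ne_zero (rep z.val).2.2 (hinj (by rw [h1, map_zero]))
    · intro h0
      have := hrep z'.val
      rw [h0, map_zero, mul_eq_zero] at this
      rcases this with h1 | h1
      · exact hz' h1
      · exact nonZeroDivisors.ne_zero (rep z'.val).2.2 (hinj (by rw [h1, map_zero]))
  · intro z hz
    have hz0 : (z : FractionRing (MvPolynomial ι F)) ≠ 0 := z.ne_zero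
    have hrep' : (z : FractionRing (MvPolynomial ι F)) *
        algebraMap (MvPolynomial ι F) (FractionRing (MvPolynomial ι F))
          ((1 : nonZeroDivisors (MvPolynomial ι F)) : MvPolynomial ι F) =
        algebraMap (MvPolynomial ι F) (FractionRing (MvPolynomial ι F))
          (C (algebraMap A F ϖ)) := by
      rw [OneMemClass.coe_one, map_one, mul_one, hz]
    have h := hval _ _ _ _ _ hz0 (hrep z.val) hrep'
    change Multiplicative.ofAdd (c (rep z.val).1 - c ((rep z.val).2 : MvPolynomial ι F)) = _
    rw [h, OneMemClass.coe_one, hc1, hcp, sub_zero]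

end Gauss

/-! ## Finitely generated extensions of `F = Frac A` -/

/-- Every finitely generated field extension `L` of the fraction field `F` of a discrete valuation
ring `A` with uniformizer `ϖ` admits a homomorphism `L^× → ℤ` that does not vanish at `ϖ`
(transcendence basis `t`; the norm `N_{L/F(t)}`; the Gauss `ϖ`-order of `F(t)`).
[cite: MochizukiTopics2003, Lem 4.14 p.48] -/
theorem exists_unitsHom_of_essFiniteType_of_irreducible (A F : Type) [CommRing A] [IsDomain A]
    [IsDiscreteValuationRing A] [Field F] [Algebra A F] [IsFractionRing A F] {ϖ : A}
    (hϖ : Irreducible ϖ) (L : Type) [Field L] [Algebra F L] [Algebra.EssFiniteType F L] :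
    ∃ w : Lˣ →* Multiplicative ℤ,
      ∀ h0 : algebraMap F L (algebraMap A F ϖ) ≠ 0,
        w (Units.mk0 (algebraMap F L (algebraMap A F ϖ)) h0) ≠ 1 := by
  have hϖF0 : algebraMap A F ϖ ≠ 0 :=
    (map_ne_zero_iff _ (IsFractionRing.injective A F)).mpr hϖ.ne_zero
  -- a transcendence basis inside a finite generating set
  obtain ⟨s, hs⟩ := IntermediateField.fg_top F L
  have halg : Algebra.IsAlgebraic (Algebra.adjoin F (s : Set L)) L := by
    rw [← IntermediateField.isAlgebraic_adjoin_iff_top, hs, Algebra.isAlgebraic_iff_isIntegral]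
    exact Algebra.isIntegral_of_surjective IntermediateField.topEquiv.surjective
  obtain ⟨t, -, ht⟩ := exists_isTranscendenceBasis_subset (R := F) (s : Set L)
  set F' : IntermediateField F L :=
    IntermediateField.adjoin F (Set.range ((↑) : t → L)) with hF'
  haveI : Algebra.EssFiniteType F' L := Algebra.EssFiniteType.of_comp F F' L
  haveI : Algebra.IsAlgebraic F' L := ht.isAlgebraic_field
  haveI : Module.Finite F' L := Algebra.finite_of_essFiniteType_of_isAlgebraic
  have hd : 0 < Module.finrank F' L := Module.finrank_pos
  -- the `ϖ`-order of `F(t) ≅ F'`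
  obtain ⟨u, hu⟩ := exists_unitsHom_fractionRing_mvPolynomial_of_irreducible A F hϖ t
  set e : FractionRing (MvPolynomial t F) ≃ₐ[F] F' := ht.1.aevalEquivField with he
  set eU : (F' : Type)ˣ →* (FractionRing (MvPolynomial t F))ˣ :=
    Units.map ((e.symm : F' ≃ₐ[F] FractionRing (MvPolynomial t F)) :
      F' →* FractionRing (MvPolynomial t F)) with heU
  set NU : Lˣ →* (F' : Type)ˣ := Units.map (Algebra.norm F' : L →* F') with hNU
  refine ⟨u.comp (eU.comp NU), fun h0 => ?_⟩
  -- the value at `ϖ`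
  have hpF : (algebraMap (MvPolynomial t F) (FractionRing (MvPolynomial t F))
      (C (algebraMap A F ϖ))) ≠ 0 := by
    rw [map_ne_zero_iff _ (IsFractionRing.injective _ _)]
    exact C_eq_zero.not.mpr hϖF0
  set zp : (FractionRing (MvPolynomial t F))ˣ := Units.mk0 _ hpF with hzp
  have hzpval : u zp = Multiplicative.ofAdd 1 := hu zp rfl
  have hkey : eU (NU (Units.mk0 (algebraMap F L (algebraMap A F ϖ)) h0)) =
      zp ^ Module.finrank F' L := by
    apply Units.ext
    rw [Units.val_pow_eq_pow_val, hzp, Units.val_mk0, heU, Units.coe_map, hNU, Units.coe_map,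
      Units.val_mk0, MonoidHom.coe_coe]
    change e.symm (Algebra.norm F' (algebraMap F L (algebraMap A F ϖ))) = _
    have hpL : algebraMap F L (algebraMap A F ϖ) = algebraMap F' L (algebraMap F F' (algebraMap A F ϖ)) :=
      (IsScalarTower.algebraMap_apply F F' L _)
    rw [hpL, Algebra.norm_algebraMap, map_pow]
    congr 1
    rw [AlgEquiv.commutes, IsScalarTower.algebraMap_apply F (MvPolynomial t F)
      (FractionRing (MvPolynomial t F)), MvPolynomial.algebraMap_eq]
  rw [MonoidHom.comp_apply, MonoidHom.comp_apply, hkey, map_pow, hzpval, ← ofAdd_nsmul,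
    nsmul_eq_mul, mul_one]
  intro h
  have := congrArg Multiplicative.toAdd h
  simp only [toAdd_ofAdd, toAdd_one] at this
  exact hd.ne' (by exact_mod_cast this)

end Literature.AnabelianGeometry.AbsoluteAnabelian
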